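import Mathlib
import Summits.Ventures.PercRepro2.A3CutScale

/-!
# The fibres of a vertex behind a cut vertex
(blind cell PercRepro2, night-1 g32; proofs/NIGHT1-G32.md §5; the expansion is A3CutExpand.lean)

Setting of A3CutFibres: `x` a cut vertex, the marks `o, a₁, a₂, b` on the `B`-side, `v` on the `A`-side.
On `{v ↔ x}` (an `A`-side event, `connEvent_vx_eq_sideEvent`) the cluster of `v` is the cluster of `x`
(`fibre_v_inter_conn`); off it the cluster of `v` is its `A`-side cluster, a set inside `VA`, and the fibre is
the product of that `A`-side cluster event with `Q` (`fibre_v_inter_compl`).  Hence `mW_v_eq`, `Ssig_v_eq`,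
`Su_v_eq`: the `v`-masses are the `{v ↔ x}`-restricted `x`-masses plus, on the sets not containing `x`, the
`A`-side cluster probability times the unconditioned `B`-side masses; `sum_aV_notMem`: the `A`-side clusters
of `v` avoiding `x` have total mass `1 − P(v ↔ x)`.  Standard axioms.
-/

namespace Summit.Ventures.PercRepro2

open UnionCluster CovForm CutV

namespace CovForm

namespace A3Fibre

/-! ## The fibres of a vertex behind the cut -/

section Behind

variable {V : Type*} {E : Type*} [Fintype V] [DecidableEq V] [Fintype E] [DecidableEq E]
  {R : Type*} [CommRing R] {ends : E → Sym2 V} {x : V} {VA VB : Finset V} {EA EB : Set E}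
  [DecidablePred (· ∈ EA)] [DecidablePred (· ∈ EB)] {p : E → R}

omit [Fintype V] [DecidableEq V] [Fintype E] [DecidableEq E] [DecidablePred (· ∈ EB)] in
/-- The event `{v ↔_A x}` is the connection event `{v ↔ x}`. -/
lemma connEvent_vx_eq_sideEvent (h : IsCut ends x ↑VA ↑VB EA EB) {v : V} (hv : v ∈ VA) :
    connEvent ends v x = sideEvent EA (connEvent ends v x) :=
  connEvent_eq_sideEvent h (Or.inl (Finset.mem_coe.2 hv)) (Or.inr rfl)

omit [Fintype V] [DecidableEq V] [Fintype E] [DecidableEq E] [DecidablePred (· ∈ EA)]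
  [DecidablePred (· ∈ EB)] in
/-- On `{v ↔ x}` the fibre of `v` is the fibre of `x`. -/
lemma fibre_v_inter_conn (a₁ a₂ v : V) (W : Finset V) :
    fibre ends a₁ a₂ v W ∩ connEvent ends v x = fibre ends a₁ a₂ x W ∩ connEvent ends v x := by
  ext ω
  simp only [fibre, Set.mem_inter_iff, mem_clusterEvent, mem_connEvent]
  constructor
  · rintro ⟨⟨hQ, hc⟩, hvx⟩
    exact ⟨⟨hQ, by rw [← cluster_eq_of_conn hvx, hc]⟩, hvx⟩
  · rintro ⟨⟨hQ, hc⟩, hvx⟩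
    exact ⟨⟨hQ, by rw [cluster_eq_of_conn hvx, hc]⟩, hvx⟩

omit [Fintype V] [Fintype E] [DecidableEq E] in
/-- Off `{v ↔ x}` the fibre of `v ∈ VA` at a set not containing `x` is the `A`-side cluster event of `v`
intersected with `Q`; at a set containing `x` it is empty. -/
lemma fibre_v_inter_compl (h : IsCut ends x ↑VA ↑VB EA EB) {v : V} (hv : v ∈ VA) (a₁ a₂ : V)
    (W : Finset V) :
    fibre ends a₁ a₂ v W ∩ (connEvent ends v x)ᶜ =
      if x ∈ W then ∅ else sideEvent EA (clusterEvent ends v (↑W : Set V)) ∩ avoidAll ends a₂ {a₁} := by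
  ext ω
  simp only [fibre, Set.mem_inter_iff, mem_clusterEvent, Set.mem_compl_iff, mem_connEvent]
  split_ifs with hxW
  · simp only [Set.mem_empty_iff_false, iff_false, not_and, not_not]
    rintro ⟨_, hc⟩
    rw [← mem_cluster, hc]
    exact Finset.mem_coe.2 hxW
  · constructor
    · rintro ⟨⟨hQ, hc⟩, hvx⟩
      have hvx' : ¬ Conn ends (restrict EA ω) v x := fun hc' => hvx (conn_mono (restrict_le EA ω) hc')
      refine ⟨?_, hQ⟩
      show cluster ends (restrict EA ω) v = ↑W
      rw [← cluster_eq_of_not_conn h (Finset.mem_coe.2 hv) hvx', hc]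
    · rintro ⟨hc, hQ⟩
      have hc' : cluster ends (restrict EA ω) v = ↑W := hc
      have hvx' : ¬ Conn ends (restrict EA ω) v x := by
        intro hcx
        apply hxW
        have : x ∈ cluster ends (restrict EA ω) v := hcx
        rw [hc'] at this
        exact Finset.mem_coe.1 this
      refine ⟨⟨hQ, by rw [cluster_eq_of_not_conn h (Finset.mem_coe.2 hv) hvx', hc']⟩, ?_⟩
      intro hvx
      exact hvx' ((conn_iff_restrict h (Or.inl (Finset.mem_coe.2 hv)) (Or.inr rfl)).mp hvx)

omit [Fintype V] in
/-- The `v`-fibre mass splits: the `Z`-restricted `x`-mass plus the `A`-side cluster mass times `P(Q)`. -/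
lemma mW_v_eq (h : IsCut ends x ↑VA ↑VB EA EB) {v : V} (hv : v ∈ VA) {a₁ a₂ : V} (h1 : a₁ ∈ insert x VB)
    (h2 : a₂ ∈ insert x VB) (W : Finset V) :
    mW p ends a₁ a₂ v W = mZ p ends a₁ a₂ x (connEvent ends v x) W +
      (if x ∈ W then 0 else
        prob p (sideEvent EA (clusterEvent ends v (↑W : Set V))) * prob p (avoidAll ends a₂ {a₁})) := by
  unfold mW mZ
  rw [← prob_inter_add_prob_inter_compl p (fibre ends a₁ a₂ v W) (connEvent ends v x),
    fibre_v_inter_conn, fibre_v_inter_compl h hv]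
  congr 1
  split_ifs with hxW
  · exact prob_empty p
  · have e : sideEvent EA (clusterEvent ends v (↑W : Set V)) ∩ avoidAll ends a₂ {a₁} =
        sideEvent EA (clusterEvent ends v (↑W : Set V)) ∩ sideEvent EB (avoidAll ends a₂ {a₁}) := by
      rw [← avoidAll_eq_sideEventB' h h1 h2]
    rw [e, prob_sideEvent_inter_eq_mul p h, ← avoidAll_eq_sideEventB' h h1 h2]

omit [Fintype V] in
/-- The `v`-fibre–connection mass splits. -/
lemma prob_fibre_v_conn_eq (h : IsCut ends x ↑VA ↑VB EA EB) {v : V} (hv : v ∈ VA) {a₁ a₂ : V}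
    (h1 : a₁ ∈ insert x VB) (h2 : a₂ ∈ insert x VB) {r y : V} (hr : r ∈ insert x VB) (hy : y ∈ insert x VB) (W : Finset V) :
    prob p (fibre ends a₁ a₂ v W ∩ connEvent ends r y) =
      prob p (fibre ends a₁ a₂ x W ∩ connEvent ends v x ∩ connEvent ends r y) +
      (if x ∈ W then 0 else
        prob p (sideEvent EA (clusterEvent ends v (↑W : Set V))) *
          prob p (avoidAll ends a₂ {a₁} ∩ connEvent ends r y)) := by
  rw [← prob_inter_add_prob_inter_compl p (fibre ends a₁ a₂ v W ∩ connEvent ends r y)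
    (connEvent ends v x)]
  have e1 : fibre ends a₁ a₂ v W ∩ connEvent ends r y ∩ connEvent ends v x =
      fibre ends a₁ a₂ x W ∩ connEvent ends v x ∩ connEvent ends r y := by
    rw [Set.inter_right_comm, fibre_v_inter_conn]
  have e2 : fibre ends a₁ a₂ v W ∩ connEvent ends r y ∩ (connEvent ends v x)ᶜ =
      fibre ends a₁ a₂ v W ∩ (connEvent ends v x)ᶜ ∩ connEvent ends r y := by
    rw [Set.inter_right_comm]
  rw [e1, e2, fibre_v_inter_compl h hv]
  congr 1
  split_ifs with hxW
  · rw [Set.empty_inter]; exact prob_empty p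
  · have e : sideEvent EA (clusterEvent ends v (↑W : Set V)) ∩ avoidAll ends a₂ {a₁} ∩ connEvent ends r y =
        sideEvent EA (clusterEvent ends v (↑W : Set V)) ∩
          sideEvent EB (avoidAll ends a₂ {a₁} ∩ connEvent ends r y) := by
      rw [← sideEvent_inter, ← avoidAll_eq_sideEventB' h h1 h2, ← connEvent_eq_sideEventB' h hr hy,
        Set.inter_assoc]
    rw [e, prob_sideEvent_inter_eq_mul p h, ← sideEvent_inter, ← avoidAll_eq_sideEventB' h h1 h2,
      ← connEvent_eq_sideEventB' h hr hy]

omit [Fintype V] in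
/-- The `σ_y`-mass of `v` splits. -/
lemma Ssig_v_eq (h : IsCut ends x ↑VA ↑VB EA EB) {v : V} (hv : v ∈ VA) {a₁ a₂ : V} (h1 : a₁ ∈ insert x VB)
    (h2 : a₂ ∈ insert x VB) {y : V} (hy : y ∈ insert x VB) (W : Finset V) :
    Ssig p ends a₁ a₂ v y W = SsigZ p ends a₁ a₂ x y (connEvent ends v x) W +
      (if x ∈ W then 0 else
        prob p (sideEvent EA (clusterEvent ends v (↑W : Set V))) *
          (prob p (avoidAll ends a₂ {a₁} ∩ connEvent ends a₁ y) -
            prob p (avoidAll ends a₂ {a₁} ∩ connEvent ends a₂ y))) := by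
  unfold Ssig SsigZ
  rw [prob_fibre_v_conn_eq h hv h1 h2 h1 hy, prob_fibre_v_conn_eq h hv h1 h2 h2 hy]
  split_ifs <;> ring

omit [Fintype V] in
/-- The `U_y`-mass of `v` splits. -/
lemma Su_v_eq (h : IsCut ends x ↑VA ↑VB EA EB) {v : V} (hv : v ∈ VA) {a₁ a₂ : V} (h1 : a₁ ∈ insert x VB)
    (h2 : a₂ ∈ insert x VB) {y : V} (hy : y ∈ insert x VB) (W : Finset V) :
    Su p ends a₁ a₂ v y W = SuZ p ends a₁ a₂ x y (connEvent ends v x) W +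
      (if x ∈ W then 0 else
        prob p (sideEvent EA (clusterEvent ends v (↑W : Set V))) *
          (prob p (avoidAll ends a₂ {a₁} ∩ connEvent ends a₁ y) +
            prob p (avoidAll ends a₂ {a₁} ∩ connEvent ends a₂ y))) := by
  unfold Su SuZ
  rw [prob_fibre_v_conn_eq h hv h1 h2 h1 hy, prob_fibre_v_conn_eq h hv h1 h2 h2 hy]
  split_ifs <;> ring

omit [DecidablePred (· ∈ EB)] in
/-- The `A`-side clusters of `v` avoiding `x` have total mass `1 − P(v ↔ x)`. -/
lemma sum_aV_notMem (h : IsCut ends x ↑VA ↑VB EA EB) {v : V} (hv : v ∈ VA) :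
    ∑ W : Finset V, (if x ∈ W then 0 else prob p (sideEvent EA (clusterEvent ends v (↑W : Set V)))) =
      1 - prob p (connEvent ends v x) := by
  have key : ∀ W : Finset V,
      (if x ∈ W then 0 else prob p (sideEvent EA (clusterEvent ends v (↑W : Set V)))) =
        prob p (sideEvent EA (clusterEvent ends v (↑W : Set V) ∩ (connEvent ends v x)ᶜ)) := by
    intro W
    split_ifs with hxW
    · symm
      have : sideEvent EA (clusterEvent ends v (↑W : Set V) ∩ (connEvent ends v x)ᶜ) = ∅ := by
        ext ω
        simp only [mem_sideEvent, Set.mem_inter_iff, mem_clusterEvent, Set.mem_compl_iff,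
          mem_connEvent, Set.mem_empty_iff_false, iff_false, not_and, not_not]
        intro hc
        rw [← mem_cluster, hc]
        exact Finset.mem_coe.2 hxW
      rw [this, prob_empty]
    · congr 1
      ext ω
      simp only [mem_sideEvent, Set.mem_inter_iff, mem_clusterEvent, Set.mem_compl_iff, mem_connEvent]
      constructor
      · intro hc
        refine ⟨hc, fun hvx => hxW ?_⟩
        have : x ∈ cluster ends (restrict EA ω) v := hvx
        rw [hc] at this
        exact Finset.mem_coe.1 this
      · exact fun hc => hc.1
  simp_rw [key]
  -- the `A`-side clusters of `v` partition `{v ↮_A x}`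
  have hpart : ∑ W : Finset V,
      prob p (sideEvent EA (clusterEvent ends v (↑W : Set V) ∩ (connEvent ends v x)ᶜ)) =
        prob p (sideEvent EA (connEvent ends v x)ᶜ) := by
    unfold prob
    rw [Finset.sum_comm]
    refine Finset.sum_congr rfl fun ω _ => ?_
    by_cases hZ : ω ∈ sideEvent EA (connEvent ends v x)ᶜ
    · have key' : ∀ W : Finset V,
          (sideEvent EA (clusterEvent ends v (↑W : Set V) ∩ (connEvent ends v x)ᶜ)).indicator
              (weight p) ω =
            (clusterEvent ends v (↑W : Set V)).indicator (fun _ => weight p ω) (restrict EA ω) := by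
        intro W
        by_cases hW : restrict EA ω ∈ clusterEvent ends v (↑W : Set V)
        · rw [Set.indicator_of_mem hW, Set.indicator_of_mem]
          exact ⟨hW, hZ⟩
        · rw [Set.indicator_of_notMem hW, Set.indicator_of_notMem]
          intro hc; exact hW hc.1
      simp_rw [key']
      rw [sum_indicator_clusterEvent, Set.indicator_of_mem hZ]
    · rw [Set.indicator_of_notMem hZ]
      refine Finset.sum_eq_zero fun W _ => ?_
      rw [Set.indicator_of_notMem]
      intro hc; exact hZ hc.2
  rw [hpart]
  have : sideEvent EA (connEvent ends v x)ᶜ = (connEvent ends v x)ᶜ := by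
    ext ω
    simp only [mem_sideEvent, Set.mem_compl_iff, mem_connEvent]
    exact not_congr (conn_iff_restrict h (Or.inl (Finset.mem_coe.2 hv)) (Or.inr rfl)).symm
  rw [this, prob_compl]

end Behind

end A3Fibre

end CovForm

end Summit.Ventures.PercRepro2
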